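import Summits.BirchSwinnertonDyer.BirchSwinnertonDyer.Theorems.ResidualThetaTransportAtTwoRlfTwistedEventualLiftAtP
import Summits.BirchSwinnertonDyer.BirchSwinnertonDyer.Theorems.ResidualThetaTransportAtTwoRlfTwistedPlusLocEngineIncl
import Summits.BirchSwinnertonDyer.BirchSwinnertonDyer.Theorems.ResidualThetaTransportAtTwoRlfTwistedUniformExponent
import HarnessLib

/-!
# Road T for item 23110: **(LIFT⁺₂)(u) IS A THEOREM modulo H-PLUSDUAL(u) and H-FIN(u)** — the twisted `+`-lifting package at the
# place above `2` assembled from (R3) (this seat's twisted `+`-local LOC engine, unconditional at `2`) and the EVENTUAL Poitou–Tate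
# lifting with one prescribed class at the place above `2` (brick (B2)), its tower input supplied by the lead's (D5) uniform exponent

Route `ResidualThetaTransportAtTwo` (RTT, crux r201 `ResidualLambdaFormulaNegDiscAtTwo`, stmt-BirchSwinnertonDyer-23110) /
`ThetaPartnerAtTwo` (TP2). Seat `prover-bsd-wall-tp2-p2x-w3` g12; `--supports stmt-BirchSwinnertonDyer-23110`. THEOREMS ONLY (no
definition, no named fact, no `sorry`); route-independent; closes nothing.

(LIFT⁺₂)(u) (lead memo RLF-TWIST-ROAD-g12 §2; the `hlift` binder of `TwistedSurj.rlf2_of_twistedDescent` and of every door of road T):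
«for every `c ∈ H = H¹(ℚ_Σ/ℚ_∞, E[2^∞])` (`unramifiedOutside (ker κ) E[2^∞] 2 S₀`) with `ψ_u c = u·conj_γ c − c ∈ K₂⁺` there is `c' ∈ H`
with `u·conj_γ c' = c'` and `c − c' ∈ K₂⁺`» — Greenberg's surjectivity «`H¹(F_Σ/F, A_s) → 𝒫^{(p)}(A_s, F_∞)^Γ` onto the classes coming
from `H`» (LNM 1716, p. 124) for Kobayashi's `+` condition.

* `liftPlusTwo_of_plusDual_of_eigen` — `E/ℚ` globally minimal, `GoodSS E 2`, `a₂ = 0`, `κ` cyclotomic with topological generator `γ`,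
  `u` odd, `S₀ ∌ 2` containing the bad places; GIVEN the two named inputs of the lead's (D5)
  `TwistedPT.hlevEventual_two_of_plusDual_of_eigen` at `ε = 1` — H-PLUSDUAL `hdual` (B. D. Kim 2007 Prop. 3.18 read at `2`, twisted,
  level `ℚ`) and H-FIN `hfinE` (bounded exponent of the `u`-eigenclasses of `Sel♯`) — (LIFT⁺₂)(u) HOLDS. Proof: `c' = twistedTorsionToH1 y`
  where — with `v₀` the place above `2` (unique; `Γ_{ℚ_{v₀}}` carries a lift `g` of `γ`, `conj_γ = conj_{res g}` on `H¹(ℚ_∞, ·)`) —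
  (R3) `SignedEC.TwistedLocalDescent.exists_twistedTorsion_localLift_plusKummer_two_incl` turns `ψ_u c ∈ K⁺_{v₀}` into a local target
  `x₀ ∈ H¹(Γ_{ℚ_{v₀}}, E[2^{J₀}](χ_u))`, the eventual Poitou–Tate lifting
  `TwistedPT.exists_mem_selmerGroup_relaxed_sub_map_incl_mem_localKummer_of_poitouTate` (pair `𝓖^A_{S₀} ≤ 𝓖^A_{S₀ ∪ {v ∣ 2}}`; tower
  input ⟸ `tower_of_uniform_exponent` ⟸ `uniformExponent_of_plusDual_of_eigen` ⟸ `hdual`, `hfinE`, through `tower_relaxed_of_tower_signed`;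
  PT over `ℚ`, the Weil pairing, `E(ℚ_∞)[2^∞] = 0`, divisibility, unramifiedness discharged in-tree exactly as in the lead's (D5))
  produces `J' ≥ J₀` and a global `y ∈ H¹(Γ_ℚ, E[2^{J'}](χ_u))` unramified outside `S₀ ∪ {2}` with `res_{v₀} y − H¹(ι) x₀` in the
  signed local Kummer condition; then `u·conj_γ c' = c'` (`zsmul_conjH1_twistedTorsionToH1`), `c' ∈ H`
  (`MultTransportTwistedDescent.twistedTorsionToH1_mem_unramifiedOutside`), and `c − c' ∈ K₂⁺` ((R3) at `v₀` + the `⨅_σ` for free: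
  `mem_iInf_comap_conjH1_localKummer_of_forall_mem`).

STATE OF 23110 AFTER THIS FILE (with the door `…RlfOfPlusDualDoor`): every rank ⟸ PRINT {WL@2, Prop. 4.12} + H-PLUSDUAL(u) + H-FIN(u) for
generic odd `u` — the (LIFT⁺₂) binder is DISCHARGED. HONEST FRAMING: closes nothing; `hdual`, `hfinE` are NOT proved here; 23110 is
NOT proved; BSD is not proved by any of this.
References: [GreenbergLNM1716] §4 Props. 4.13–4.14 and p. 124; [Howard2004HeegnerKolyvagin] Thm. 2.1.11; [Kobayashi2003] Def. 1.1, §8.4;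
B. D. Kim, Compositio Math. 143 (2007), Props. 3.15–3.18.
-/

-- the Theorems namespace of this sub repeats the summit name by design (D-0017 nested layout)
set_option linter.dupNamespace false

noncomputable section

open scoped Classical NumberField

open NumberField IsDedekindDomain Field
open Literature.NumberTheory.EllipticCurves Literature.NumberTheory.GaloisRepresentations
  Literature.NumberTheory.GaloisCohomology WeierstrassCurve ZpExtension Literature.NumberTheory.EllipticCurves.Kobayashi2003
  Literature.NumberTheory.EllipticCurves.GreenbergVatsal2000
open Literature.NumberTheory.GaloisRepresentations.DiscreteGaloisModule (localTatePairingZMod unramifiedSubgroup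
  SelmerStructure TateDual tateDual)

namespace Summit.BirchSwinnertonDyer.BirchSwinnertonDyer.Theorems.SignedEC.TwistedPT

/-- Places of `ℚ` containing `2` coincide (maximality of `(2) ⊂ 𝓞 ℚ ≅ ℤ`). [cite: SerreLocalFields1979, I §1] -/
private theorem eq_of_two_mem_asIdeal {v v' : HeightOneSpectrum (𝓞 ℚ)} (hv : ((2 : ℕ) : 𝓞 ℚ) ∈ v.asIdeal)
    (hv' : ((2 : ℕ) : 𝓞 ℚ) ∈ v'.asIdeal) : v = v' := by
  have hprime : Prime ((2 : ℕ) : 𝓞 ℚ) := by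
    rw [← MulEquiv.prime_iff (Rat.ringOfIntegersEquiv : 𝓞 ℚ ≃+* ℤ).toMulEquiv]
    change Prime (Rat.ringOfIntegersEquiv ((2 : ℕ) : 𝓞 ℚ))
    rw [map_natCast, ← Nat.prime_iff_prime_int]
    exact Nat.prime_two
  have hspan : ∀ w : HeightOneSpectrum (𝓞 ℚ), ((2 : ℕ) : 𝓞 ℚ) ∈ w.asIdeal →
      Ideal.span {((2 : ℕ) : 𝓞 ℚ)} = w.asIdeal := fun w hw ↦ by
    have hP : (Ideal.span {((2 : ℕ) : 𝓞 ℚ)}).IsPrime := (Ideal.span_singleton_prime hprime.ne_zero).mpr hprime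
    exact (hP.isMaximal (by rw [Ne, Ideal.span_singleton_eq_bot]; exact hprime.ne_zero)).eq_of_le
      w.isPrime.ne_top ((Ideal.span_singleton_le_iff_mem _).mpr hw)
  exact HeightOneSpectrum.ext ((hspan v hv).symm.trans (hspan v' hv'))

set_option maxHeartbeats 1600000 in
/-- **(LIFT⁺₂)(u) from H-PLUSDUAL(u) and H-FIN(u).** See the module docstring. The hypotheses `hdual`, `hfinE` are VERBATIM the binders of
`TwistedPT.hlevEventual_two_of_plusDual_of_eigen` at `ε = 1`; the conclusion is VERBATIM the `hlift` binder of
`TwistedSurj.rlf2_of_twistedDescent` / `TwistedLocalDescent.rlf2_of_twistedPlusDualDescent`.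
[cite: GreenbergLNM1716, §4 Prop. 4.13 Remark (p. 122), Prop. 4.14 and p. 124] [cite: Howard2004HeegnerKolyvagin, Thm. 2.1.11]
[cite: Kobayashi2003, Def. 1.1, §8.4] -/
theorem liftPlusTwo_of_plusDual_of_eigen (E : WeierstrassCurve ℚ) [E.IsElliptic] [E.IsGloballyMinimal]
    (hss : Rank1Residual.GoodSS E 2) (ha : E.frobeniusTrace 2 = 0) (S₀ : Finset (HeightOneSpectrum (𝓞 ℚ)))
    (κ : ZpExtension ℚ 2) (hκ : κ.IsCyclotomic) {γ : Field.absoluteGaloisGroup ℚ} (hγ : κ.IsTopGenerator γ) (u : ℤ)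
    (hu : (2 : ℤ) ∣ u - 1) (hS2 : ∀ v ∈ S₀, ((2 : ℕ) : 𝓞 ℚ) ∉ v.asIdeal)
    (hS : ∀ v : HeightOneSpectrum (𝓞 ℚ), ¬ E.HasGoodReductionAt v → v ∈ S₀)
    (hdual : ∀ (J : ℕ) (u' : ℤ) (hu' : (2 : ℤ) ∣ u' - 1) (huu' : ((2 : ℤ) ^ J) ∣ u * u' - 1)
      (e : E.geomTorsion ((2 ^ J : ℕ) : ℤ) → E.geomTorsion ((2 ^ J : ℕ) : ℤ) → AlgebraicClosure ℚ)
      (hμ : ∀ S T, e S T ^ (2 ^ J) = 1) (hadd₁ : ∀ S₁ S₂ T, e (S₁ + S₂) T = e S₁ T * e S₂ T)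
      (hadd₂ : ∀ S T₁ T₂, e S (T₁ + T₂) = e S T₁ * e S T₂)
      (hgal : ∀ (σ : absoluteGaloisGroup ℚ) (S T : E.geomTorsion ((2 ^ J : ℕ) : ℤ)), σ • e S T = e (σ • S) (σ • T))
      [Finite (E.geomTorsion ((2 ^ J : ℕ) : ℤ))]
      (inv : LocalInvariants ℚ (2 ^ J)), inv.IsPerfect → inv.SumLocalTermEqZero → inv.UnramifiedOrthogonal →
      ∀ (v : HeightOneSpectrum (𝓞 ℚ)), ((2 : ℕ) : 𝓞 ℚ) ∈ v.asIdeal →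
      ∀ y' : galoisCohomology ((E.twistedTorsionGaloisModule 2 κ J u' hu').restrictField (v.adicCompletion ℚ)) 1,
        galoisCohomology.map ((E.twistedWeilDual 2 κ J hu hu' huu' e hμ hadd₁ hadd₂ hgal).restrictField (v.adicCompletion ℚ)) 1 y' ∈
            inv.dualLocalCondition (E.twistedTorsionGaloisModule 2 κ J u hu) (Sum.inr v)
              (E.twistedTorsionLocalKummer 2 κ J u hu (v.adicCompletion ℚ)
                (⨆ n : ℕ, signedLocalPoints κ (v.adicCompletion ℚ) E 1 n)) →
        y' ∈ E.twistedTorsionLocalKummer 2 κ J u' hu' (v.adicCompletion ℚ) (⨆ n : ℕ, signedLocalPoints κ (v.adicCompletion ℚ) E 1 n))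
    (hfinE : ∃ e : ℕ, ∀ c ∈ unramifiedOutside κ.kerSubgroup ↥(E.geomPrimaryTorsion 2) 2 (↑S₀ : Set (HeightOneSpectrum (𝓞 ℚ))) ⊓
        ⨅ (v : HeightOneSpectrum (𝓞 ℚ)) (_ : ((2 : ℕ) : 𝓞 ℚ) ∈ v.asIdeal) (σ : Field.absoluteGaloisGroup ℚ),
          (localKummerOverOfEmb E 2 κ.kerSubgroup (closureEmb (K := ℚ) (v.adicCompletion ℚ))
            (⨆ n : ℕ, signedLocalPoints κ (v.adicCompletion ℚ) E 1 n)).comap (E.conjH1 2 κ.kerSubgroup σ),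
      E.conjH1 2 κ.kerSubgroup γ c = u • c → 2 ^ e • c = 0) :
    ∀ c ∈ unramifiedOutside κ.kerSubgroup ↥(E.geomPrimaryTorsion 2) 2 (↑S₀ : Set (HeightOneSpectrum (𝓞 ℚ))),
      u • E.conjH1 2 κ.kerSubgroup γ c - c ∈
        ⨅ (v : HeightOneSpectrum (𝓞 ℚ)) (_ : ((2 : ℕ) : 𝓞 ℚ) ∈ v.asIdeal) (σ : Field.absoluteGaloisGroup ℚ),
          (localKummerOverOfEmb E 2 κ.kerSubgroup (closureEmb (K := ℚ) (v.adicCompletion ℚ))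
            (⨆ n : ℕ, signedLocalPoints κ (v.adicCompletion ℚ) E 1 n)).comap (E.conjH1 2 κ.kerSubgroup σ) →
      ∃ c' ∈ unramifiedOutside κ.kerSubgroup ↥(E.geomPrimaryTorsion 2) 2 (↑S₀ : Set (HeightOneSpectrum (𝓞 ℚ))),
        u • E.conjH1 2 κ.kerSubgroup γ c' = c' ∧ c - c' ∈
          ⨅ (v : HeightOneSpectrum (𝓞 ℚ)) (_ : ((2 : ℕ) : 𝓞 ℚ) ∈ v.asIdeal) (σ : Field.absoluteGaloisGroup ℚ),
            (localKummerOverOfEmb E 2 κ.kerSubgroup (closureEmb (K := ℚ) (v.adicCompletion ℚ))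
              (⨆ n : ℕ, signedLocalPoints κ (v.adicCompletion ℚ) E 1 n)).comap (E.conjH1 2 κ.kerSubgroup σ) := by
  intro c hcH hψ
  -- no place above `2`? (never) — then `K₂⁺ = ⊤` and `c' = 0` does it
  by_cases hex : ∃ v₀ : HeightOneSpectrum (𝓞 ℚ), ((2 : ℕ) : 𝓞 ℚ) ∈ v₀.asIdeal
  swap
  · refine ⟨0, zero_mem _, by rw [map_zero, zsmul_zero], ?_⟩
    rw [sub_zero]
    exact AddSubgroup.mem_iInf.2 fun v ↦ AddSubgroup.mem_iInf.2 fun hv ↦ (hex ⟨v, hv⟩).elim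
  obtain ⟨v₀, hv₀⟩ := hex
  have hv₀S : v₀ ∉ S₀ := fun h ↦ hS2 v₀ h hv₀
  have huniq : ∀ v : HeightOneSpectrum (𝓞 ℚ), ((2 : ℕ) : 𝓞 ℚ) ∈ v.asIdeal → v = v₀ :=
    fun v hv ↦ eq_of_two_mem_asIdeal hv hv₀
  -- the in-tree inputs (as in the lead's (D5) `hlevEventual_two_of_plusDual_of_eigen`)
  haveI hfin : ∀ J : ℕ, Finite (E.geomTorsion ((2 ^ J : ℕ) : ℤ)) := fun J ↦
    haveI : NeZero (2 ^ J) := ⟨pow_ne_zero _ two_ne_zero⟩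
    finite_geomTorsion_of_neZero E (2 ^ J)
  have hPT : poitouTate_selmerStructure_duality ℚ :=
    SchneiderFreeAdditiveX3.PoitouTateReduction.poitouTate_selmerStructure_duality_holds ℚ
  have hdiv : E.zsmul_geomPoints_surjective := E.zsmul_geomPoints_surjective_holds
  have hgood : ∀ v : HeightOneSpectrum (𝓞 ℚ), v ∉ (↑S₀ : Set (HeightOneSpectrum (𝓞 ℚ))) → ((2 : ℕ) : 𝓞 ℚ) ∉ v.asIdeal →
      E.HasGoodReductionAt v := fun v hv _ ↦ by
    by_contra h; exact hv (Finset.mem_coe.2 (hS v h))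
  have hSJ : ∀ (J : ℕ) (v : HeightOneSpectrum (𝓞 ℚ)), (Sum.inr v : Place ℚ) ∉ twistedDescentPlaces (K := ℚ) 2 S₀ →
      ((2 ^ J : ℕ) : 𝓞 ℚ) ∉ v.asIdeal ∧ GaloisRep.IsUnramifiedAt v (E.twistedTorsionGaloisModule 2 κ J u hu) := by
    intro J v hv
    rw [not_mem_twistedDescentPlaces_iff] at hv
    exact E.natCast_pow_not_mem_and_isUnramifiedAt_twistedTorsionGaloisModule 2 κ J u hu hgood
      (fun h ↦ hv.1 (Finset.mem_coe.1 h)) hv.2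
  have hbot := SignedTransportAtTwo.fixedPoints_kerSubgroup_eq_bot_of_goodSS E hss κ
  have hfix : ∀ P : E.geomPrimaryTorsion 2, (∀ h : κ.kerSubgroup, h • P = P) → P = 0 := by
    intro P hP
    have hmem : P ∈ FixedPoints.addSubgroup κ.kerSubgroup (E.geomPrimaryTorsion 2) := by
      rw [FixedPoints.mem_addSubgroup]; exact hP
    rw [hbot] at hmem
    exact (AddSubgroup.mem_bot).mp hmem
  have hfixJ : ∀ (J : ℕ) (T : E.geomTorsion ((2 ^ J : ℕ) : ℤ)),
      (∀ h : absoluteGaloisGroup ℚ, h ∈ κ.kerSubgroup → h • T = T) → T = 0 := by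
    intro J T hT
    have h0 := hfix (AddSubgroup.inclusion
      (Literature.Barriers.BirchSwinnertonDyer.geomTorsion_pow_le_geomPrimaryTorsion E 2 J) T) (fun h ↦ by
        apply Subtype.ext
        rw [primaryComponent.coe_smul, AddSubgroup.coe_inclusion, Subgroup.smul_def, ← AddSubgroup.torsionBy.coe_smul,
          hT h h.2])
    have h1 := congrArg (fun b : E.geomPrimaryTorsion 2 ↦ (b : E.geomPoints)) h0
    simp only [AddSubgroup.coe_inclusion, ZeroMemClass.coe_zero] at h1
    exact Subtype.ext h1
  -- no twisted invariants in `Hom(ker π, μ)` (Weil pairing)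
  have hinv : ∀ (j J : ℕ) (hjJ : j ≤ J) (m : TateDual ℚ (E.geomTorsion ((2 ^ J : ℕ) : ℤ)) (2 ^ J)),
      (∀ (g : absoluteGaloisGroup ℚ) (R : E.geomTorsion ((2 ^ J : ℕ) : ℤ)), E.twistedTorsionMulPow 2 κ hjJ u hu R = 0 →
        ((E.twistedTorsionGaloisModule 2 κ J u hu).tateDual (2 ^ J) g m - m) R = 0) →
      ∀ R : E.geomTorsion ((2 ^ J : ℕ) : ℤ), E.twistedTorsionMulPow 2 κ hjJ u hu R = 0 → m R = 0 := by
    intro j J hjJ m hm R hR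
    rcases Nat.eq_zero_or_pos J with hJ0 | hJpos
    · subst hJ0
      have hR0 : R = 0 := Subtype.ext (by
        have h : ((2 ^ 0 : ℕ) : ℤ) • (R : E.geomPoints) = 0 := (Submodule.mem_torsionBy_iff _ _).mp R.2
        simp only [pow_zero, Nat.cast_one, one_smul] at h
        exact h)
      rw [hR0, map_zero]
    obtain ⟨eW, hμ, hadd₁, hadd₂, -, hnondeg, hgal⟩ := WeierstrassCurve.exists_weilPairing_holds E (2 ^ J)
      (le_trans (le_refl 2) (Nat.le_self_pow (by omega) 2)) (by exact_mod_cast pow_ne_zero J two_ne_zero)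
    obtain ⟨u', hu', huu'⟩ := exists_inverse_twist (p := 2) hu J
    exact E.forall_apply_eq_zero_of_tateDual_sub_apply_eq_zero 2 κ hjJ hu hu' huu' eW hμ hadd₁ hadd₂ hgal hnondeg hdiv
      (hfixJ J) m hm R hR
  -- the uniform exponent (D5), the tower (D4c), and the tower for the RELAXED structure
  have hexp := uniformExponent_of_plusDual_of_eigen E 2 S₀ κ u hu (fun v ↦ ⨆ n : ℕ, signedLocalPoints κ (v.adicCompletion ℚ) E 1 n)
    hγ hS2 hSJ hfix (fun J u' hu' huu' e hμ hadd₁ hadd₂ hgal ↦ hdual J u' hu' huu' e hμ hadd₁ hadd₂ hgal) hfinE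
  have htower := E.tower_of_uniform_exponent 2 κ u hu hdiv
    (fun J ↦ E.twistedSignedSelmerStructure 2 S₀ κ J u hu (fun v ↦ ⨆ n : ℕ, signedLocalPoints κ (v.adicCompletion ℚ) E 1 n))
    hinv hexp
  have htower' := tower_relaxed_of_tower_signed E 2 S₀ κ u hu
    (fun v ↦ ⨆ n : ℕ, signedLocalPoints κ (v.adicCompletion ℚ) E 1 n) htower
  -- a local lift `g` of `γ` at `v₀`; `conj_γ = conj_{res g}` on `H¹(ℚ_∞, E[2^∞])`
  obtain ⟨g, hg⟩ := hκ.exists_isTopGenerator_resGalOfEmb_adicCompletion v₀ hv₀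
  have hconj : E.conjH1 2 κ.kerSubgroup γ c =
      E.conjH1 2 κ.kerSubgroup (resGalOfEmb (closureEmb (K := ℚ) (v₀.adicCompletion ℚ)) g) c :=
    SignedKatoOffTwo.KummerPoint.conjH1_eq_conjH1_resGalOfEmb E κ v₀ g γ (by rw [hγ, hg]) c
  -- `ψ_u c` at `v₀` (`σ = 1`)
  have hψv₀ : u • E.conjH1 2 κ.kerSubgroup (resGal (K := ℚ) (v₀.adicCompletion ℚ) g) c - c ∈
      localKummerOverOfEmb E 2 κ.kerSubgroup (closureEmb (K := ℚ) (v₀.adicCompletion ℚ))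
        (⨆ n : ℕ, signedLocalPoints κ (v₀.adicCompletion ℚ) E 1 n) := by
    have h1 := AddSubgroup.mem_iInf.1 (AddSubgroup.mem_iInf.1 (AddSubgroup.mem_iInf.1 hψ v₀) hv₀) 1
    rw [AddSubgroup.mem_comap, E.conjH1_of_mem_holds 2 κ.kerSubgroup (one_mem _), AddMonoidHom.id_apply, hconj] at h1
    exact h1
  -- (R3): the local target `x₀` at a fixed level `J₀`
  have hu' : ((2 : ℕ) : ℤ) ∣ u - 1 := by exact_mod_cast hu
  obtain ⟨J₀, x₀, hx₀⟩ := TwistedLocalDescent.exists_twistedTorsion_localLift_plusKummer_two_incl E κ hss ha hκ v₀ hv₀ hg hu'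
    c hψv₀
  -- (B2): the eventual Poitou–Tate lifting with the prescribed class `x₀` at `v₀` modulo the `+` condition
  let x : ∀ v : HeightOneSpectrum (𝓞 ℚ),
      galoisCohomology ((E.twistedTorsionGaloisModule 2 κ J₀ u hu).restrictField (v.adicCompletion ℚ)) 1 :=
    fun v ↦ if h : v = v₀ then h ▸ x₀ else 0
  have hxv₀ : x v₀ = x₀ := by simp only [x, dif_pos]
  obtain ⟨J', hJ, y, hySel, hyloc⟩ := exists_mem_selmerGroup_relaxed_sub_map_incl_mem_localKummer_of_poitouTate E 2 S₀ κ u hu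
    (fun v ↦ ⨆ n : ℕ, signedLocalPoints κ (v.adicCompletion ℚ) E 1 n) hPT hSJ htower' J₀ x
  have hy₀ := hyloc v₀ hv₀ hv₀S
  rw [hxv₀] at hy₀
  -- `c' = twistedTorsionToH1 y`
  refine ⟨E.twistedTorsionToH1 2 κ J' u hu y, ?_, E.zsmul_conjH1_twistedTorsionToH1 2 κ J' u hu hγ y, ?_⟩
  · refine MultTransportTwistedDescent.twistedTorsionToH1_mem_unramifiedOutside E 2 κ J' u hu _ y (fun v hv hpv ↦ ?_)
    have hv' : v ∉ S₀ ∪ WeierstrassCurve.placesAbove (K := ℚ) 2 := by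
      rw [Finset.mem_union, not_or, WeierstrassCurve.mem_placesAbove_iff]
      exact ⟨fun h ↦ hv (Finset.mem_coe.2 h), hpv⟩
    exact E.res_mem_unramifiedSubgroup_of_mem_selmerGroup_signedRelaxed 2 _ κ J' u hu _ hySel hv' hpv
  · refine mem_iInf_comap_conjH1_localKummer_of_forall_mem E κ hκ 1 fun v hv ↦ ?_
    obtain rfl := huniq v hv
    exact hx₀ J' hJ y hy₀

end Summit.BirchSwinnertonDyer.BirchSwinnertonDyer.Theorems.SignedEC.TwistedPT

end
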